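import Summits.RiemannHypothesis.RiemannHypothesis.Theses.SignCone
import Summits.RiemannHypothesis.RiemannHypothesis.Theorems.SignConeConeMagnificationCompactness
import Summits.RiemannHypothesis.RiemannHypothesis.Theorems.SignConeConeMagnificationKernel
import Literature.NumberTheory.LFunctions.WeilExplicit
import Literature.NumberTheory.LFunctions.GeneralizedRH

/-!
# Stub `stub_fakePNT` of line `Sketch` for crux `SignCone.ConeMagnification`
(item stmt-RiemannHypothesis-16303, route route-RiemannHypothesis-SignCone)

POSITIVE-DEFINITENESS ⇒ BOUNDED DISCREPANCY.  If a weight `c ≥ 0` has unit slack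
`-‖φ‖₂² ≤ Re (W_ar − P_c)(φ ⋆ φ̃)` against EVERY Weil test `φ`, then for every Weil test `g`, with
`G = g ⋆ g̃` (`= weilConv g (weilReflect g)`), the smoothed fake prime sum of the translates of `G` tracks the
polar main term within a constant:
`‖Σₙ c(n) n^{-1/2} (G(x + log n) + G(x − log n)) − e^{x/2} Ĝ(0) − e^{-x/2} Ĝ(1)‖ ≤ C` for all real `x`.

Proof: with the translate `T = G(· + x) = weilTranslate G (-x)` and the fake Weil form
`Φ_c(K) = W_ar(K) − P_c(K) + K(0)`, one has `P_c(T) = W_polar(T) + W_∞(T) + G(x) − Φ_c(T)`, where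
`W_polar(T) = e^{x/2} Ĝ(0) + e^{-x/2} Ĝ(1)` (`weilPolarTerm_weilTranslate`), `‖W_∞(T)‖ ≤ (1/2π)∫‖Ĝ Re ψ‖ + ‖G(x)‖ log π`
(`norm_weilArchTerm_weilTranslate_le`), `‖G(x)‖ ≤ M` (continuous, compact support) and
`‖Φ_c(T)‖ ≤ Re Φ_c(G)` — the translation/polarisation bound `norm_fakeForm_weilTranslate_le` obtained from
unit slack at the translate mixes `g + γ g(· − x)`, `|γ| = 1`.
-/

noncomputable section

-- `Summit.RiemannHypothesis.RiemannHypothesis.…` repeats a namespace component by design (D-0017 layout).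
set_option linter.dupNamespace false

open scoped BigOperators ComplexConjugate Topology
open Complex MeasureTheory Set Filter

namespace Summit.RiemannHypothesis.RiemannHypothesis.Theorems.SignConeConeMagnification

open Literature.NumberTheory.LFunctions
open Summit.RiemannHypothesis.RiemannHypothesis.Theorems.SignCone

/-- Re-indexing the fake prime sum of the translate `G(· + x) = weilTranslate G (-x)`:
`Σₙ c(n) n^{-1/2} (G(x + log n) + G(x − log n)) = P_c(weilTranslate G (-x))`. [folklore] -/
theorem fakeSum_translate_eq_tsum_weilTranslate (c : ℕ → ℝ) (G : ℝ → ℂ) (x : ℝ) :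
    (∑' n : ℕ, ((c n : ℝ) : ℂ) / (Real.sqrt n : ℂ) * (G (x + Real.log n) + G (x - Real.log n))) =
      ∑' n : ℕ, ((c n : ℝ) : ℂ) / (Real.sqrt n : ℂ) *
        (weilTranslate G (-x) (Real.log n) + weilTranslate G (-x) (-Real.log n)) := by
  refine tsum_congr fun n => ?_
  simp only [weilTranslate, sub_neg_eq_add]
  rw [add_comm (Real.log n) x, neg_add_eq_sub]

/-- **Stub 1 — `fakePNT` (positive-definiteness ⇒ bounded discrepancy).**  If `c ≥ 0` has unit
slack against every Weil test, then for every Weil test `g`, with `K = g ⋆ g̃`, the fake prime sum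
of the translates of `K` tracks the polar term within a constant:
`sup_x ‖Σₙ c(n) n^{-1/2}(K(x + log n) + K(x − log n)) − e^{x/2} K̂(0) − e^{-x/2} K̂(1)‖ < ∞`
(`norm_fakeForm_weilTranslate_le`, `weilPolarTerm_weilTranslate`, `norm_weilArchTerm_weilTranslate_le`).
[folklore] -/
theorem stub_fakePNT :
    ∀ c : ℕ → ℝ, (∀ n, 0 ≤ c n) →
      (∀ g : ℝ → ℂ, IsWeilTest g →
        -(∫ t, ‖g t‖ ^ 2) ≤
          (weilPolarTerm (weilConv g (weilReflect g)) + weilArchTerm (weilConv g (weilReflect g)) -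
            ∑' n : ℕ, ((c n : ℝ) : ℂ) / (Real.sqrt n : ℂ) *
              (weilConv g (weilReflect g) (Real.log n) + weilConv g (weilReflect g) (-Real.log n))).re) →
      ∀ g : ℝ → ℂ, IsWeilTest g → ∃ C : ℝ, ∀ x : ℝ,
        ‖(∑' n : ℕ, ((c n : ℝ) : ℂ) / (Real.sqrt n : ℂ) *
            (weilConv g (weilReflect g) (x + Real.log n) + weilConv g (weilReflect g) (x - Real.log n))) -
          Complex.exp (x / 2) * weilMellin (weilConv g (weilReflect g)) 0 -
          Complex.exp (-(x / 2)) * weilMellin (weilConv g (weilReflect g)) 1‖ ≤ C := by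
  intro c _ hU g hg
  set G : ℝ → ℂ := weilConv g (weilReflect g) with hG
  have hGt : IsWeilTest G := hg.weilConv hg.weilReflect
  obtain ⟨M, hM⟩ : ∃ M : ℝ, ∀ v, ‖G v‖ ≤ M :=
    hGt.1.continuous.bounded_above_of_compact_support hGt.2
  -- the fake Weil form `Φ_c`
  set Φ : (ℝ → ℂ) → ℂ := fun K => weilPolarTerm K + weilArchTerm K -
    (∑' n : ℕ, ((c n : ℝ) : ℂ) / (Real.sqrt n : ℂ) * (K (Real.log n) + K (-Real.log n))) + K 0 with hΦ
  refine ⟨1 / (2 * Real.pi) * (∫ t : ℝ, ‖weilMellin G (1 / 2 + t * I) *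
      ((Complex.digamma (1 / 4 + t / 2 * I)).re : ℂ)‖) + M * Real.log Real.pi + M + (Φ G).re, ?_⟩
  intro x
  set T : ℝ → ℂ := weilTranslate G (-x) with hT
  -- the bound on the fake form of the translate
  have hEb : ‖Φ T‖ ≤ (Φ G).re := norm_fakeForm_weilTranslate_le hU hg (-x)
  -- `P_c(T) = polar + arch + T 0 - Φ T`
  have hP : (∑' n : ℕ, ((c n : ℝ) : ℂ) / (Real.sqrt n : ℂ) * (G (x + Real.log n) + G (x - Real.log n))) =
      weilPolarTerm T + weilArchTerm T + T 0 - Φ T := by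
    rw [fakeSum_translate_eq_tsum_weilTranslate c G x, ← hT]
    simp only [hΦ]
    ring
  have hT0 : T 0 = G x := by simp [hT, weilTranslate]
  have hpol : weilPolarTerm T = cexp ((x : ℂ) / 2) * weilMellin G 0 + cexp (-((x : ℂ) / 2)) * weilMellin G 1 := by
    rw [hT, weilPolarTerm_weilTranslate]
    simp only [Complex.ofReal_neg, neg_div, neg_neg]
  have hA : ‖weilArchTerm T‖ ≤
      1 / (2 * Real.pi) * (∫ t : ℝ, ‖weilMellin G (1 / 2 + t * I) *
        ((Complex.digamma (1 / 4 + t / 2 * I)).re : ℂ)‖) + ‖G x‖ * Real.log Real.pi := by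
    have h := norm_weilArchTerm_weilTranslate_le hGt (-x)
    rw [neg_neg] at h
    exact h
  have hlogπ : 0 ≤ Real.log Real.pi := Real.log_nonneg (by linarith [Real.pi_gt_three])
  have hM0 : 0 ≤ M := (norm_nonneg _).trans (hM 0)
  rw [hP, hpol, hT0]
  calc ‖cexp ((x : ℂ) / 2) * weilMellin G 0 + cexp (-((x : ℂ) / 2)) * weilMellin G 1 + weilArchTerm T + G x -
        Φ T - cexp ((x : ℂ) / 2) * weilMellin G 0 - cexp (-((x : ℂ) / 2)) * weilMellin G 1‖
      = ‖weilArchTerm T + G x + (-Φ T)‖ := by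
        congr 1; ring
    _ ≤ ‖weilArchTerm T‖ + ‖G x‖ + ‖-Φ T‖ := norm_add₃_le
    _ ≤ (1 / (2 * Real.pi) * (∫ t : ℝ, ‖weilMellin G (1 / 2 + t * I) *
          ((Complex.digamma (1 / 4 + t / 2 * I)).re : ℂ)‖) + ‖G x‖ * Real.log Real.pi) + M + (Φ G).re := by
        rw [norm_neg]
        exact add_le_add (add_le_add hA (hM x)) hEb
    _ ≤ _ := by nlinarith [hM x, norm_nonneg (G x)]

end Summit.RiemannHypothesis.RiemannHypothesis.Theorems.SignConeConeMagnification

end
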